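import Summits.ResolutionOfSingularities.ResolutionOfSingularities.Theorems.FrobeniusLadderFRationalResolutionVeroneseConeResolution
import Summits.ResolutionOfSingularities.ResolutionOfSingularities.Theorems.FrobeniusLadderFRationalResolutionVeroneseSummand
import Summits.ResolutionOfSingularities.ResolutionOfSingularities.Theorems.FrobeniusLadderFRationalResolutionVeroneseMemIff
import Summits.ResolutionOfSingularities.ResolutionOfSingularities.Theorems.FrobeniusLadderFRationalResolutionVeroneseVertexSingular
import Summits.ResolutionOfSingularities.ResolutionOfSingularities.Theorems.FrobeniusLadderFRationalResolutionVeroneseDimension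
import Summits.ResolutionOfSingularities.ResolutionOfSingularities.Theorems.FrobeniusLadderFRationalResolutionClauseOfRetractRegular
import Mathlib.RingTheory.RegularLocalRing.Polynomial
import HarnessLib

/-!
# Cone programme, Veronese family: in the residual class, singular, and resolved — every field, every `n, r ≥ 2`

Support file for crux stmt-ResolutionOfSingularities-15317 (`FrobeniusLadder.FRationalResolution`), line `redirect`,
CONE PROGRAMME — the packaged statement for the Veronese cones `V(n,r) = Spec VR[n,r]`, `VR[n,r] = k[χᵈ : |d| = r]`
(`= 𝔸ⁿ/μ_r`, weights `(1,…,1)`, wild for `p ∣ r`), assembled from the landed worker stubs: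
* `veroneseCone_residualClass` — `VR[n,r]` is a domain with EVERY ideal tightly closed (inline clause of route
  `FrobeniusLadder`; a fortiori the crux hypothesis on parameter ideals): direct summand of `k[x₁,…,xₙ]`
  (`stub_veronese_retract` over `stub_veronese_mem_iff` / `stub_finsupp_degree_split`) and Hochster–Huneke 1990
  Prop. 4.12 (`stub_clause_of_retract_regular`);
* `veroneseCone_not_isRegularRing` — for `n, r ≥ 2` the ring `VR[n,r]` is NOT regular: the localization at the vertex
  (the kernel of the constant coefficient, which contains every `χᵈ`) is not a regular local ring
  (`stub_veronese_vertex_not_regular` with `stub_veronese_ringKrullDim`);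
* `veroneseCone_singular_residualClass_hasResolution` — together with `hasResolution_veroneseCone`: a SINGULAR member of
  the residual class of every dimension `n ≥ 2`, every characteristic, with a resolution of singularities in Lean.
[folklore; HochsterHuneke1990 Prop. 4.12; BrunsHerzog1998 Ex. 2.2.24; Kollár 2007 §2.2] -/

-- single-problem summit: the doubled namespace component is forced
set_option linter.dupNamespace false

noncomputable section

namespace Summit.ResolutionOfSingularities.ResolutionOfSingularities.Theorems.FRationalResolution

open MvPolynomial AlgebraicGeometry
open Literature.AlgebraicGeometry.Resolution

section Cones

variable (k : Type) [Field k]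

/-- The polynomial ring in `n` variables. -/
local notation3 "MP[" n "]" => MvPolynomial (Fin n) k

/-- The `r`-th Veronese subring of `k[x₁,…,xₙ]`: the `k`-subalgebra generated by the degree-`r` monomials. -/
local notation3 "VR[" n ", " r "]" =>
  Algebra.adjoin k ((fun d : Fin n →₀ ℕ => MvPolynomial.monomial d (1 : k)) ''
    {d : Fin n →₀ ℕ | Finsupp.degree d = (r : ℕ)})

/-- **The Veronese cones lie in the residual class** (all primes `p`, all fields `k` of characteristic `p`, all `n`,
`r ≥ 1`): `VR[n,r]` is a domain and every ideal of it is tightly closed in the inline sense of route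
`FrobeniusLadder` — direct summand of the regular domain `k[x₁,…,xₙ]`, Hochster–Huneke 1990 Prop. 4.12.
[folklore; HochsterHuneke1990 Prop. 4.12] -/
theorem veroneseCone_residualClass (p : ℕ) [Fact p.Prime] [CharP k p] (n r : ℕ) (hr : 1 ≤ r) :
    IsDomain ↥VR[n, r] ∧ ∀ I : Ideal ↥VR[n, r], ∀ y c : ↥VR[n, r], c ≠ 0 →
      (∀ e : ℕ, c * y ^ p ^ e ∈ Ideal.span ((fun z : ↥VR[n, r] => z ^ p ^ e) '' (I : Set ↥VR[n, r]))) → y ∈ I := by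
  obtain ⟨ρ, h1, h2⟩ := stub_veronese_retract k n r hr
    (stub_veronese_mem_iff k n r hr (fun s d hd => stub_finsupp_degree_split r s d hd))
  haveI : CharP MP[n] p := inferInstance
  exact stub_clause_of_retract_regular p (VR[n, r]).val.toRingHom ρ Subtype.val_injective h1 h2

/-- **The Veronese cone `V(n,r)` is singular for `n, r ≥ 2`:** `VR[n,r]` is not a regular ring, since its localization
at the vertex — the kernel of the constant coefficient `VR[n,r] → k`, a prime containing every degree-`r` monomial —
is not a regular local ring (`stub_veronese_vertex_not_regular`: embedding dimension `C(n+r-1, r) > n = dim`,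
`stub_veronese_ringKrullDim`). [folklore; BrunsHerzog1998 Ex. 2.2.24] -/
theorem veroneseCone_not_isRegularRing (n r : ℕ) (hn : 2 ≤ n) (hr : 2 ≤ r) : ¬ IsRegularRing ↥VR[n, r] := by
  classical
  intro hreg
  -- the vertex: kernel of the constant coefficient
  let ε : ↥VR[n, r] →+* k := (constantCoeff : MP[n] →+* k).comp (VR[n, r]).val.toRingHom
  let q : PrimeSpectrum ↥VR[n, r] := ⟨RingHom.ker ε, RingHom.ker_isPrime ε⟩
  have hq : ∀ v : ↥VR[n, r], (∃ d : Fin n →₀ ℕ, Finsupp.degree d = r ∧ (v : MP[n]) = monomial d 1) →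
      v ∈ q.asIdeal := by
    rintro v ⟨d, hd, hv⟩
    have hd0 : d ≠ 0 := by
      rintro rfl
      rw [map_zero] at hd
      omega
    change ε v = 0
    simp only [ε, RingHom.comp_apply]
    change constantCoeff (v : MP[n]) = 0
    rw [hv, constantCoeff_monomial, if_neg hd0]
  have h := stub_veronese_vertex_not_regular k n r hn hr (stub_veronese_ringKrullDim k n r (by omega)) q hq
  exact h (@IsRegularRing.isRegularLocalRing_localization _ _ hreg q.asIdeal q.isPrime)

/-- **THE VERONESE CONES: SINGULAR MEMBERS OF THE RESIDUAL CLASS WITH A RESOLUTION, IN EVERY DIMENSION AND EVERY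
CHARACTERISTIC.** For every prime `p`, every field `k` of characteristic `p` and all `n, r ≥ 2`: the Veronese cone ring
`VR[n,r] = k[χᵈ : |d| = r]` is a domain with every ideal tightly closed (`veroneseCone_residualClass`), is NOT regular
(`veroneseCone_not_isRegularRing`), and `Spec VR[n,r]` HAS a resolution of singularities (`hasResolution_veroneseCone`:
one blow-up of the vertex). Rung 4′ of the crux holds on this family unconditionally. [folklore] -/
theorem veroneseCone_singular_residualClass_hasResolution (p : ℕ) [Fact p.Prime] [CharP k p] (n r : ℕ)
    (hn : 2 ≤ n) (hr : 2 ≤ r) :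
    (IsDomain ↥VR[n, r] ∧ ∀ I : Ideal ↥VR[n, r], ∀ y c : ↥VR[n, r], c ≠ 0 →
      (∀ e : ℕ, c * y ^ p ^ e ∈ Ideal.span ((fun z : ↥VR[n, r] => z ^ p ^ e) '' (I : Set ↥VR[n, r]))) → y ∈ I) ∧
    ¬ IsRegularRing ↥VR[n, r] ∧ Scheme.HasResolution (Spec (CommRingCat.of ↥VR[n, r])) :=
  ⟨veroneseCone_residualClass k p n r (by omega), veroneseCone_not_isRegularRing k n r hn hr,
    hasResolution_veroneseCone k n r (by omega) ⟨0, by omega⟩⟩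

end Cones

end Summit.ResolutionOfSingularities.ResolutionOfSingularities.Theorems.FRationalResolution

end
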